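import Mathlib
import Summits.ValiantsHypothesis.ValiantsHypothesis.Theses.FreeSubtorus
import Summits.ValiantsHypothesis.ValiantsHypothesis.Cruxes.OrbitDimensionBound.Lines.GaugeLadder
import Literature.Computability.AlgebraicComplexity.GrenetEquivariant
import Summits.ValiantsHypothesis.ValiantsHypothesis.Theorems.FreeSubtorusOrbitDimensionBoundStubNilpotentGauge
import Summits.ValiantsHypothesis.ValiantsHypothesis.Theorems.FreeSubtorusOrbitDimensionBoundStubGaugeReduction

/-!
# Line `affine_gauge` — skeleton for the rung `Gauge.AffineGaugeShadow` (affine-gauge covering bound)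

Crux advanced: `OrbitDimensionBound` (stmt-ValiantsHypothesis-16133) of `route-ValiantsHypothesis-FreeSubtorus`; floor
`SubtorusCovering` (PROVED, `subtorusCovering_proof`); rung `Gauge.AffineGaugeShadow` / numeric `Gauge.AffineGaugeCovering
= GaugeCovering 1` (`Lines/GaugeLadder.lean`, sorry-free: `q = 0` IS the floor, `S → GaugeShadow q` for every `q`).

THE LINE.  `AffineGaugeShadow ⇐ AffineGaugeCovering ⇐ GaugeTorusBound 1` (the `r = 0` engine at gauge degree `1`)
`⇐ untwisting + the LANDED engine at q = 0` (`gaugeTorusBound_zero` = `stub_torusBound`).  Three registered stubs: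
* `stub_nilpotentGauge` (M; NEW, provable — the STRUCTURE of affine unimodular gauge): a polynomial matrix `g` with
  entries of total degree `≤ 1` and `det g ∈ ℂˣ` factors as `g = C(g₀) · (1 + N)` with `g₀ ∈ GL_m(ℂ)` (`g₀ = g(0)`,
  invertible because `det g₀ = det g`), `N` with homogeneous LINEAR entries and `N^m = 0` (homogeneity: `det(1+N) = 1`
  forces every `e_k(N) = 0`, Cayley–Hamilton over `ℂ[x]`).  So degree-`1` lifts are "constant × unipotent Koszul
  twist" — the normal form `NilLifts`.  Tools: `Matrix.aeval_self_charpoly`, `Matrix.det_one_add_smul`-type expansions,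
  `MvPolynomial.totalDegree`, `IsHomogeneous`.
* `stub_untwist` (L; NEW — the load-bearing, OPEN core; "torus cohomology with unipotent-twist coefficients vanishes"):
  for `n ≥ 3`, an affine determinantal representation `B` of `per_n` with normal-form lifts of EVERY two-sided torus
  substitution is unimodularly equivalent AT THE SAME SIZE to an affine representation `u·B·v` of `per_n` with CONSTANT
  lifts (`GaugeLifts 0`).  Why plausibly true: `ℂ[x]/(per_n)` is a normal graded domain, so `Aut(coker B) = ℂˣ` and the
  cokernel module of a gauge-symmetric `B` carries a genuine rational `T`-linearisation (central extension of a torus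
  by `𝔾_m` splits; equivalently Brion, arXiv:1312.6267 Thm. 2.14: line bundles on a NORMAL `T`-variety are
  `T`-linearisable since `Pic(T) = 0` — applied on the regular locus of `V(per_n)`, normal by von zur Gathen's
  `codim Sing ≥ 5`, and extended by `S₂`); the twisted Grenet matrix of `Disproof.lean` §4 untwists by `u = 1 - V`, `v = 1 - U`.  Why it might
  fail: a `T`-linearised cokernel need not admit an equivariant AFFINE presentation of the same size `m` (size/degree
  trade-off of graded presentations); degree-`1` twists do not form a group and lifts are not unique modulo `Stab(B)`.
* `stub_gaugeReduction` (M; the floor's own reduction, ported): `GaugeTorusBound 1 → AffineGaugeCovering` — sacrifice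
  an independent set of `≤ r` pairs by the floor's permutation-pattern substitution (`stub_indepMatching`, `stub_relabel`,
  `stub_torusExtension`, `stub_substPer` of `Theorems/FreeSubtorusSubtorusCovering.lean` are symmetry-agnostic); the
  one changed step is `stub_substLifts`: a substitution is a ring map, so it preserves total degree `≤ 1` and unit
  determinants — degree-`1` lifts of the EXTENDED torus element (an element of `subtorusGen`, no composition of lifts
  needed) descend to degree-`1` lifts of the residual full torus; then `(2^{n-r'} - 1) · 2^{r'} ≥ C(n,⌊n/2⌋)`
  (`choose_middle_le_two_pow_pred`, tree).
Composition `gaugeTorusBound_one_of`, `AffineGaugeCovering_of`, `AffineGaugeShadow_of`: kernel-checked below, sorries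
ONLY in `stub_*`.

Disproof used (`Cruxes/OrbitDimensionBound/Disproof.lean`): §4's `twistedGrenet_no_homothety_lift` /
`not_inPlaceHomothety` / `not_orbitDimensionBoundInPlace` say symmetry cannot be imposed IN PLACE with CONSTANT lifts;
this line's relaxed target `OrbitGaugeBound 1` (ladder §5) asks for symmetry in place MODULO AFFINE GAUGE, and the §4
witness satisfies it (`Lines/affine_gauge_witness.lean`); §3 (`homothetySymmetrisation_of_orbitDimensionBound`: any
symmetrising subtorus contains the homotheties) is honoured — homotheties lift with affine gauge on the twisted Grenet
matrix; no `-- Targets` stub of §6 is instantiated; `orbitDimensionBound_false_without_repHyp` (the representation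
hypothesis is needed) is respected: every statement here carries `IsAffineDetRepr`.
[cite: LandsbergRessayre2017, Def. 1.3, Thm. 2.8, Question 2.2] [cite: Grenet2011, Thm. 1] [cite: MignonRessayre2004, §1]
-/

set_option linter.dupNamespace false

noncomputable section

namespace Summit.ValiantsHypothesis.ValiantsHypothesis.Cruxes.OrbitDimensionBound.Gauge.Line

open Matrix MvPolynomial Finset
open Literature.Computability.AlgebraicComplexity
open Summit.ValiantsHypothesis.ValiantsHypothesis.Cruxes.OrbitDimensionBound.Confusion
open Summit.ValiantsHypothesis.ValiantsHypothesis.Cruxes.OrbitDimensionBound.Gauge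

/-! ## §1 Statements of the stubs -/

/-- **Normal-form lifts** `NilLifts S B`: every `γ ∈ S` lifts as `B(γ·x) · (C h₀ · (1 + N_h)) = (C g₀ · (1 + N_g)) · B`
with `g₀, h₀ ∈ GL_m(ℂ)` and `N_g, N_h` matrices of homogeneous LINEAR forms that are nilpotent (`N^m = 0`): "constant ×
unipotent Koszul twist".  This is what a degree-`1` unimodular lift looks like (`stub_nilpotentGauge`). [folklore] -/
def NilLifts {n m : ℕ} (S : Set (GL (Fin n × Fin n) ℂ))
    (B : Matrix (Fin m) (Fin m) (MvPolynomial (Fin n × Fin n) ℂ)) : Prop :=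
  ∀ γ ∈ S, ∃ (g₀ h₀ : GL (Fin m) ℂ) (Ng Nh : Matrix (Fin m) (Fin m) (MvPolynomial (Fin n × Fin n) ℂ)),
    (∀ i j, (Ng i j).IsHomogeneous 1) ∧ (∀ i j, (Nh i j).IsHomogeneous 1) ∧ Ng ^ m = 0 ∧ Nh ^ m = 0 ∧
    Matrix.linSubstEntries γ B * ((h₀ : Matrix (Fin m) (Fin m) ℂ).map C * (1 + Nh)) =
      ((g₀ : Matrix (Fin m) (Fin m) ℂ).map C * (1 + Ng)) * B

/-- Statement of stub 1 (`stub_nilpotentGauge`, M): degree-`1` unimodular lifts can be put in normal form — an affine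
matrix `g` with `det g ∈ ℂ[x]ˣ` is `C(g(0)) · (1 + N)`, `N = g(0)⁻¹ · g₁` linear with all `e_k(N) = 0` (homogeneity of
`det (1 + N) = 1`), hence `N^m = 0` (Cayley–Hamilton). [folklore] -/
def Stmt.stub_nilpotentGauge : Prop :=
  ∀ (n m : ℕ) (S : Set (GL (Fin n × Fin n) ℂ)) (B : Matrix (Fin m) (Fin m) (MvPolynomial (Fin n × Fin n) ℂ)),
    GaugeLifts 1 S B → NilLifts S B

/-- Statement of stub 2 (`stub_untwist`, L — load-bearing, OPEN): UNTWISTING for the full two-sided torus.  An affine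
determinantal representation `B` of `per_n` (`n ≥ 3`) with normal-form lifts of every torus substitution `x ↦ D₁ x D₂`
is unimodularly equivalent, at the same size, to an affine representation `u · B · v` of `per_n` with CONSTANT lifts.
Heuristic: `Aut_{ℂ[x]}(coker B) = ℂˣ` (`ℂ[x]/(per_n)` normal domain, `coker B` torsion-free of rank one on it), so the
cokernel is `T`-linearisable; the bet is that the linearisation is realised by an affine presentation of size `m`.
[cite: LandsbergRessayre2017, Question 2.2] -/
def Stmt.stub_untwist : Prop :=
  ∀ n : ℕ, 3 ≤ n → ∀ (m : ℕ) (B : Matrix (Fin m) (Fin m) (MvPolynomial (Fin n × Fin n) ℂ)),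
    IsAffineDetRepr (perPoly (Fin n) ℂ) B → NilLifts (fullTorusGen n) B →
    ∃ u v : Matrix (Fin m) (Fin m) (MvPolynomial (Fin n × Fin n) ℂ),
      IsUnit u.det ∧ IsUnit v.det ∧
      IsAffineDetRepr (perPoly (Fin n) ℂ) (u * B * v) ∧ GaugeLifts 0 (fullTorusGen n) (u * B * v)

/-- Statement of stub 3 (`stub_gaugeReduction`, M): the floor's pair-sacrifice reduction carries degree-`1` lifts —
the `r = 0` engine at gauge degree `1` implies the rung. [cite: LandsbergRessayre2017, Thm. 2.8] -/
def Stmt.stub_gaugeReduction : Prop := GaugeTorusBound 1 → AffineGaugeCovering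

/-! ## §2 The registered stubs -/

/-- Stub 1: normal form of affine unimodular gauge. [folklore] -/
theorem stub_nilpotentGauge : Stmt.stub_nilpotentGauge :=
  -- LANDED (p601028, val-lit-p4 g11); closed by name — wired 2026-08-28 by val-width-16133-w1 g2
  Summit.ValiantsHypothesis.ValiantsHypothesis.Theorems.FreeSubtorusOrbitDimensionBound.AffineGauge.stub_nilpotentGauge

/-- Stub 2: untwisting (load-bearing). [cite: LandsbergRessayre2017, Question 2.2] -/
theorem stub_untwist : Stmt.stub_untwist := by
  sorry

/-- Stub 3: the gauge-carrying pair-sacrifice reduction. [cite: LandsbergRessayre2017, Thm. 2.8] -/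
theorem stub_gaugeReduction : Stmt.stub_gaugeReduction :=
  -- LANDED (p601623, val-lit-p4 g11); closed by name — wired 2026-08-28 by val-width-16133-w1 g2
  Summit.ValiantsHypothesis.ValiantsHypothesis.Theorems.FreeSubtorusOrbitDimensionBound.AffineGauge.stub_gaugeReduction

/-! ## §3 Composition (kernel-checked, no sorry below this line) -/

/-- Stubs 1 + 2 + the LANDED `q = 0` engine give the `r = 0` engine at gauge degree `1`. [cite: LandsbergRessayre2017, Thm. 2.8] -/
theorem gaugeTorusBound_one_of (h₁ : Stmt.stub_nilpotentGauge) (h₂ : Stmt.stub_untwist) : GaugeTorusBound 1 := by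
  intro n hn m B hB hL
  obtain ⟨u, v, -, -, hB', hL'⟩ := h₂ n hn m B hB (h₁ n m (fullTorusGen n) B hL)
  exact gaugeTorusBound_zero n hn m (u * B * v) hB' hL'

/-- **The rung, numeric form, from the three stubs.** [cite: LandsbergRessayre2017, Thm. 2.8, Question 2.2] -/
theorem AffineGaugeCovering_of (h₁ : Stmt.stub_nilpotentGauge) (h₂ : Stmt.stub_untwist)
    (h₃ : Stmt.stub_gaugeReduction) : AffineGaugeCovering :=
  h₃ (gaugeTorusBound_one_of h₁ h₂)

/-- **The rung (filed declaration `AffineGaugeShadow`) from the three stubs.** [cite: LandsbergRessayre2017, Question 2.2] -/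
theorem AffineGaugeShadow_of (h₁ : Stmt.stub_nilpotentGauge) (h₂ : Stmt.stub_untwist)
    (h₃ : Stmt.stub_gaugeReduction) : AffineGaugeShadow :=
  affineGaugeShadow_of_affineGaugeCovering (AffineGaugeCovering_of h₁ h₂ h₃)

/-- The rung, assembled from the registered stubs (sorries live only inside `stub_*`). [cite: LandsbergRessayre2017, Question 2.2] -/
theorem AffineGaugeShadow_proof : AffineGaugeShadow :=
  AffineGaugeShadow_of stub_nilpotentGauge stub_untwist stub_gaugeReduction

/-- The line also re-proves the floor (rung ⇒ floor) and feeds the host route's closing with the ORIGINAL crux.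
[cite: LandsbergRessayre2017, Thm. 2.8] -/
theorem floor_of_stubs (h₁ : Stmt.stub_nilpotentGauge) (h₂ : Stmt.stub_untwist) (h₃ : Stmt.stub_gaugeReduction) :
    Summit.ValiantsHypothesis.ValiantsHypothesis.Theses.FreeSubtorus.SubtorusCovering :=
  subtorusCovering_of_gaugeCovering (AffineGaugeCovering_of h₁ h₂ h₃)

/-- … and the RELAXED closing of the host route: gauge symmetry in place + the rung ⇒ the summit.
[cite: LandsbergRessayre2017, Question 2.2] -/
theorem summit_of_stubs (h₀ : OrbitGaugeBound 1) (h₁ : Stmt.stub_nilpotentGauge) (h₂ : Stmt.stub_untwist)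
    (h₃ : Stmt.stub_gaugeReduction) : _root_.ValiantsHypothesis :=
  closes_affineGauge h₀ (AffineGaugeCovering_of h₁ h₂ h₃)

end Summit.ValiantsHypothesis.ValiantsHypothesis.Cruxes.OrbitDimensionBound.Gauge.Line

end
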